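import Literature.Geometry.Riemannian.WeinsteinCutLocus
import Literature.Geometry.Riemannian.CutLocusProofs
import HarnessLib

/-!
# Weinstein 1968 (multiplicity form) — layer 0: the conclusion `2 ≤ multiplicity`, metric side

Sibling proof file of `Literature/Geometry/Riemannian/WeinsteinCutLocus.lean`, working towards the
named fact `Weinstein1968_exists_metric_two_le_multiplicity_of_mem_cutLocus` (A. Weinstein, *The cut
locus and conjugate locus of a Riemannian manifold*, Ann. of Math. 87 (1968) 29–41: on a compact
manifold not homeomorphic to `S²` there are a metric and a point none of whose cut points is
conjugate; vendored in the multiplicity form "every cut point of `p` is joined to `p` by two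
distinct minimal geodesics", i.e. `2 ≤ minimalGeodesicMultiplicity g hg p q` on `cutLocus g hg p`).
The printed proof (zbMATH 0159.23902: surfaces by constant curvature; `n ≥ 3` by an `ε`-dense
curve of bounded geodesic curvature, a disk `D` about it with controlled second fundamental form
of `∂D`, a modification of the metric inside `D` making `exp_p` a diffeomorphism of the unit ball
onto `D`, and Warner's comparison theorem for focal points) needs the exponential map, Hopf–Rinow
(the tree's named fact `hopfRinow_compact` of `ExponentialMap.lean`, unproved), Jacobi fields and
focal points, none of which the tree has as theorems. The first step of the existence statement —
that `M` carries a smooth Riemannian metric at all — is `exists_isRiemannian`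
(`RiemannianMetricExists.lean`). This file records the **metric form of the conclusion**, which is
how the multiplicity bound is verified in every example and in the last step of the printed
argument ("two distinct minimizing geodesics have distinct midpoints"):

* `two_le_minimalGeodesicMultiplicity_iff` — `2 ≤ minimalGeodesicMultiplicity g hg p q` iff `p, q`
  have two distinct midpoints (unfolding of `Set.encard`);
* `two_le_minimalGeodesicMultiplicity_of_edist_eq` — **the symmetry principle**: a distance
  preserving self-map `σ` of `M` fixing `p` and `q` maps midpoints of `p, q` to midpoints, so a
  midpoint moved by `σ` gives multiplicity `≥ 2` (the mechanism behind the standard examples: the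
  antipode on the round `Sⁿ`, the cut locus `ℝPⁿ⁻¹` of the round `ℝPⁿ`, Besse 1978, Prop. 3.35);
* `two_le_minimalGeodesicMultiplicity_of_forall_mem_cutLocus` — hence a Riemannian metric with a
  distance-preserving self-map fixing `p` and its cut locus pointwise, and moving some midpoint of
  `p, q` for every cut point `q`, satisfies the conclusion of the fact at `p`.

No definitions and no named facts are introduced (D-0026).

## References

* A. Weinstein, Ann. of Math. 87 (1968) 29–41 [Weinstein1968]; zbMATH review Zbl 0159.23902.
* A. L. Besse, *Manifolds all of whose geodesics are closed* (1978), Prop. 3.35 (cut loci of the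
  compact rank one symmetric spaces).
* I. Chavel, *Riemannian geometry: a modern introduction*, 2nd ed. (2006), §III.2 [Chavel2006].
-/

noncomputable section

open Set
open scoped Manifold ContDiff ENNReal

namespace Literature.Geometry.Riemannian

open Literature.Geometry.Lorentzian (PseudoRiemannianMetric)
open Literature.Geometry.Lorentzian.PseudoRiemannianMetric

variable {E : Type*} [NormedAddCommGroup E] [NormedSpace ℝ E] {H : Type*} [TopologicalSpace H]
  {I : ModelWithCorners ℝ E H} {M : Type*} [TopologicalSpace M] [ChartedSpace H M]
  [IsManifold I ∞ M] {n : ℕ∞ω} [FiniteDimensional ℝ E]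
  {g : PseudoRiemannianMetric I n E (TangentSpace I : M → Type _)}

/-- **Multiplicity `≥ 2` means two distinct midpoints**: `2 ≤ minimalGeodesicMultiplicity g hg p q`
iff there are `m₁ ≠ m₂` with `d(p, mᵢ) = d(mᵢ, q)` and `d(p, mᵢ) + d(mᵢ, q) = d(p, q)` (the
multiplicity is the `Set.encard` of the set of midpoints, `CutLocus.lean`; on complete Riemannian
manifolds midpoints correspond to minimal geodesics from `p` to `q`, Chavel 2006, §III.2).
[folklore] -/
theorem two_le_minimalGeodesicMultiplicity_iff (hg : g.IsRiemannian) (p q : M) :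
    2 ≤ minimalGeodesicMultiplicity g hg p q ↔
      ∃ m₁ m₂ : M, m₁ ≠ m₂ ∧
        (g.edist hg p m₁ = g.edist hg m₁ q ∧ g.edist hg p m₁ + g.edist hg m₁ q = g.edist hg p q) ∧
        (g.edist hg p m₂ = g.edist hg m₂ q ∧ g.edist hg p m₂ + g.edist hg m₂ q = g.edist hg p q) := by
  rw [minimalGeodesicMultiplicity_eq_encard,
    show (2 : ℕ∞) = 1 + 1 from rfl, ENat.add_one_le_iff ENat.one_ne_top, Set.one_lt_encard_iff]
  constructor
  · rintro ⟨a, b, ha, hb, hab⟩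
    exact ⟨a, b, hab, ha, hb⟩
  · rintro ⟨a, b, hab, ha, hb⟩
    exact ⟨a, b, ha, hb, hab⟩

/-- **The symmetry principle for multiplicities.** Let `σ : M → M` preserve the Riemannian distance
(`d(σ x, σ y) = d(x, y)`) and fix `p` and `q`. Then `σ` maps midpoints of `p, q` to midpoints of
`p, q`; so if some midpoint `m` is moved by `σ` (`σ m ≠ m`), then `p, q` have at least two midpoints,
`2 ≤ minimalGeodesicMultiplicity g hg p q`. This is how the multiplicity of the cut points of the
round sphere (the antipode, every point of the equator being a midpoint) and of the round
projective space is computed (Besse 1978, Prop. 3.35). [folklore] -/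
theorem two_le_minimalGeodesicMultiplicity_of_edist_eq (hg : g.IsRiemannian) {σ : M → M}
    (hσ : ∀ x y, g.edist hg (σ x) (σ y) = g.edist hg x y) {p q m : M} (hp : σ p = p) (hq : σ q = q)
    (hm : g.edist hg p m = g.edist hg m q ∧ g.edist hg p m + g.edist hg m q = g.edist hg p q)
    (hσm : σ m ≠ m) : 2 ≤ minimalGeodesicMultiplicity g hg p q := by
  rw [two_le_minimalGeodesicMultiplicity_iff]
  refine ⟨σ m, m, hσm, ?_, hm⟩
  have h1 : g.edist hg p (σ m) = g.edist hg p m := by rw [← hσ p m, hp]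
  have h2 : g.edist hg (σ m) q = g.edist hg m q := by rw [← hσ m q, hq]
  rw [h1, h2]
  exact hm

/-- **A metric with enough symmetry at `p` satisfies Weinstein's conclusion at `p`.** On a compact
connected Riemannian manifold (so that midpoints exist, `exists_midpoint`), suppose that for every
cut point `q` of `p` there is a distance-preserving self-map of `M` fixing `p` and `q` and moving
some midpoint of `p, q`. Then every cut point of `p` has minimal-geodesic multiplicity `≥ 2` — the
conclusion of `Weinstein1968_exists_metric_two_le_multiplicity_of_mem_cutLocus` for this `g, p`
(as for the round `Sⁿ` and `ℝPⁿ`). [folklore] -/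
theorem two_le_minimalGeodesicMultiplicity_of_forall_mem_cutLocus (hg : g.IsRiemannian) {p : M}
    (h : ∀ q ∈ cutLocus g hg p, ∀ m : M,
      g.edist hg p m = g.edist hg m q ∧ g.edist hg p m + g.edist hg m q = g.edist hg p q →
      ∃ σ : M → M, (∀ x y, g.edist hg (σ x) (σ y) = g.edist hg x y) ∧ σ p = p ∧ σ q = q ∧ σ m ≠ m)
    [CompactSpace M] [T2Space M] [ConnectedSpace M] :
    ∀ q ∈ cutLocus g hg p, 2 ≤ minimalGeodesicMultiplicity g hg p q := by
  intro q hq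
  obtain ⟨m, hm⟩ := exists_midpoint hg p q
  obtain ⟨σ, hσ, hp, hq', hσm⟩ := h q hq m hm
  exact two_le_minimalGeodesicMultiplicity_of_edist_eq hg hσ hp hq' hm hσm

end Literature.Geometry.Riemannian

end
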